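import Mathlib
import Summits.MatrixMultiplication.MatrixMultiplication.Theorems.SnSubsetDichotomyPolynomialSlackSpreadLevelOne

/-!
# Heavy cells of a set of permutations carry only polylogarithmic mass

Crux `Summit.MatrixMultiplication.MatrixMultiplication.Theses.SnSubsetDichotomy.PolynomialSlack`
(item `stmt-MatrixMultiplication-8306`), level-one programme, line transport-split-hull (lead c6).
For `X ⊆ S_n` with marginals `M_X(i,j) = #{x ∈ X : x j = i}` (column sums `|X|`), a cell `(i,j)` is
HEAVY at level `λ` when `M_X(i,j) ≥ λ|X|/n`, i.e. it carries at least `λ` times its fair share. For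
`λ ≥ 16` the TOTAL heavy mass is small:

  `Σ_{(i,j) heavy} M_X(i,j) ≤ 200·(1 + log n)·|X|·log(4n·n!/|X|)`      (`heavy_mass_le`):

a set of permutations cannot route more than a polylogarithmic multiple of its size through
over-weighted cells. Proof: the tree's Bernstein inequality for permuted sums
(`card_permutedSum_tail_le`) applied to the heavy-cell count `W(π) = Σ_j a(π j, j)`, `a` the `0/1`
indicator of the heavy cells; its mean over `S_n` is `μ = |H|/n ≤ h/λ` (`h·|X|` the heavy mass, as every
heavy cell weighs at least `λ|X|/n`), its mean over `X` is EXACTLY `h` (KEY IDENTITY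
`Σ_{x ∈ X} W(x) = Σ a·M`, `sum_sum_apply_eq_sum_mul_marginal`), the Bernstein proxy is `32(1+log n)μ`;
one threshold `t₀ = √(64(1+log n)μL) + 16L`, `L = log(4n·n!/|X|)`, tail mass `≤ |X|/n` and `W ≤ n` give
`h ≤ 1 + μ + t₀`, and AM–GM closes `h ≤ 200(1+log n)L`. Companion of `spread_level_one` (same skeleton).
-/

namespace Summit.MatrixMultiplication.MatrixMultiplication.Theorems.PolynomialSlack

set_option linter.dupNamespace false

open scoped BigOperators

set_option maxHeartbeats 800000 in
/-- **Heavy cells carry little mass.** For `X ⊆ S_n` non-empty (`n ≥ 1`) and `λ ≥ 16`, the total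
marginal mass `Σ_{i,j : M(i,j) ≥ λ|X|/n} M(i,j)` of the cells `(i,j)` with
`M(i,j) = #{x ∈ X : x j = i} ≥ λ|X|/n` is at most `200·(1 + log n)·|X|·log(4n·n!/|X|)`.
Proof: Bernstein for permuted sums (`card_permutedSum_tail_le`) on the heavy-cell count
`W(π) = Σ_j a(π j, j)` (`a` the heavy indicator, `|a| ≤ 1`), mean `μ = |H|/n ≤ h/16` over `S_n`
(`h|X|` the heavy mass), mean `h` over `X`, `W ≤ n`, threshold `t₀ = √(64(1+log n)μL) + 16L`;
then `h ≤ 1 + μ + t₀` and AM–GM. [folklore] -/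
theorem heavy_mass_le {n : ℕ} (hn : 1 ≤ n) (X : Finset (Equiv.Perm (Fin n))) (hX : X.Nonempty)
    (lam : ℝ) (hlam : 16 ≤ lam) :
    ∑ i : Fin n, ∑ j : Fin n,
        (if lam * X.card / n ≤ ((X.filter fun x => x j = i).card : ℝ) then
          ((X.filter fun x => x j = i).card : ℝ) else 0) ≤
      200 * (1 + Real.log n) * X.card * Real.log (4 * n * n.factorial / X.card) := by
  -- notation
  set α : ℝ := (X.card : ℝ) with hα
  have hα0 : 0 < α := by rw [hα]; exact_mod_cast hX.card_pos
  have hnR : (1 : ℝ) ≤ n := by exact_mod_cast hn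
  have hn0 : (0 : ℝ) < n := by linarith
  have hlam0 : 0 < lam := by linarith
  set M : Fin n → Fin n → ℝ := fun i j => ((X.filter fun x => x j = i).card : ℝ) with hM
  have hM0 : ∀ i j, 0 ≤ M i j := fun i j => Nat.cast_nonneg _
  -- the heavy threshold and the heavy indicator
  set c : ℝ := lam * α / n with hc
  set a : Fin n → Fin n → ℝ := fun i j => if c ≤ M i j then 1 else 0 with ha
  have ha_apply : ∀ i j, a i j = if c ≤ M i j then 1 else 0 := fun i j => rfl
  have ha01 : ∀ i j, a i j = 0 ∨ a i j = 1 := fun i j => by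
    by_cases h : c ≤ M i j
    · right; rw [ha_apply, if_pos h]
    · left; rw [ha_apply, if_neg h]
  have ha0 : ∀ i j, 0 ≤ a i j := fun i j => by rcases ha01 i j with h | h <;> simp [h]
  have ha1 : ∀ i j, a i j ≤ 1 := fun i j => by rcases ha01 i j with h | h <;> simp [h]
  have hsq : ∀ i j, a i j ^ 2 = a i j := fun i j => by rcases ha01 i j with h | h <;> simp [h]
  -- the heavy mass `S = Σ a·M`
  set S : ℝ := ∑ i : Fin n, ∑ j : Fin n, a i j * M i j with hS
  have hcell : ∀ i j, (if c ≤ M i j then M i j else 0) = a i j * M i j := fun i j => by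
    by_cases h : c ≤ M i j
    · rw [if_pos h, ha_apply, if_pos h, one_mul]
    · rw [if_neg h, ha_apply, if_neg h, zero_mul]
  have hLS : ∑ i : Fin n, ∑ j : Fin n, (if c ≤ M i j then M i j else 0) = S :=
    Finset.sum_congr rfl fun i _ => Finset.sum_congr rfl fun j _ => hcell i j
  -- KEY IDENTITY: `Σ_{x ∈ X} W(x) = S`
  have hkey : ∑ x ∈ X, ∑ j : Fin n, a (x j) j = S := sum_sum_apply_eq_sum_mul_marginal X a
  -- every heavy cell weighs at least `c`: `c · |H| ≤ S`
  set Hc : ℝ := ∑ i : Fin n, ∑ j : Fin n, a i j with hHc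
  have hHc0 : 0 ≤ Hc := Finset.sum_nonneg fun i _ => Finset.sum_nonneg fun j _ => ha0 i j
  have hac : ∀ i j, c * a i j ≤ a i j * M i j := fun i j => by
    by_cases h : c ≤ M i j
    · rw [ha_apply, if_pos h, mul_one, one_mul]; exact h
    · rw [ha_apply, if_neg h, mul_zero, zero_mul]
  have hcH : c * Hc ≤ S := by
    have h1 : c * Hc = ∑ i : Fin n, ∑ j : Fin n, c * a i j := by
      rw [hHc, Finset.mul_sum]
      exact Finset.sum_congr rfl fun i _ => Finset.mul_sum _ _ _
    rw [h1, hS]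
    exact Finset.sum_le_sum fun i _ => Finset.sum_le_sum fun j _ => hac i j
  -- the mean of `W` over `S_n`
  set μ : ℝ := Hc / n with hμ
  have hμ0 : 0 ≤ μ := div_nonneg hHc0 hn0.le
  have hμS : lam * α * μ ≤ S := by
    have h1 : lam * α * μ = c * Hc := by rw [hμ, hc]; ring
    rw [h1]; exact hcH
  -- `W ≤ n` pointwise
  have hFle : ∀ x : Equiv.Perm (Fin n), ∑ j : Fin n, a (x j) j ≤ n := fun x => by
    calc ∑ j : Fin n, a (x j) j ≤ ∑ _j : Fin n, (1 : ℝ) := Finset.sum_le_sum fun j _ => ha1 _ _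
      _ = n := by simp
  -- the threshold
  set L : ℝ := Real.log (4 * n * n.factorial / X.card) with hL
  set G : ℝ := 1 + Real.log n with hG
  have hG1 : 1 ≤ G := by rw [hG]; linarith [Real.log_nonneg hnR]
  have hY : 4 ≤ 4 * n * n.factorial / α := by
    rw [le_div_iff₀ hα0]
    have hf : (1 : ℝ) ≤ n.factorial := by exact_mod_cast n.factorial_pos
    have hαle : α ≤ n.factorial := by
      rw [hα]
      have : X.card ≤ Fintype.card (Equiv.Perm (Fin n)) := Finset.card_le_univ _
      rw [Fintype.card_perm, Fintype.card_fin] at this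
      exact_mod_cast this
    nlinarith
  have hY0 : 0 < 4 * n * n.factorial / α := by linarith
  have hL1 : 1 ≤ L := by
    rw [hL, ← hα, Real.le_log_iff_exp_le hY0]
    exact le_trans Real.exp_one_lt_d9.le (by linarith)
  have hL0 : 0 < L := by linarith
  have hGL : 0 ≤ G * L := mul_nonneg (by linarith) hL0.le
  set r : ℝ := Real.sqrt (64 * G * μ * L) with hr
  have hr0 : 0 ≤ r := Real.sqrt_nonneg _
  have h64 : 0 ≤ 64 * G * μ * L := by
    have : 0 ≤ G * μ := mul_nonneg (by linarith) hμ0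
    nlinarith [hL0.le]
  have hrsq : r * r = 64 * G * μ * L := Real.mul_self_sqrt h64
  set t₀ : ℝ := r + 16 * L with ht₀
  have ht₀0 : 0 < t₀ := by rw [ht₀]; linarith
  have hproxy : 32 * (1 + Real.log n) * (∑ i : Fin n, ∑ j : Fin n, a j i ^ 2) / n = 32 * G * μ := by
    have h1 : ∑ i : Fin n, ∑ j : Fin n, a j i ^ 2 = Hc := by
      rw [hHc, Finset.sum_comm (s := Finset.univ) (t := Finset.univ) (f := fun i j => a j i ^ 2)]
      exact Finset.sum_congr rfl fun i _ => Finset.sum_congr rfl fun j _ => hsq i j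
    rw [h1, hμ, hG]; ring
  have hmean : (∑ i : Fin n, ∑ j : Fin n, a j i) / n = μ := by
    rw [hμ, hHc, Finset.sum_comm (s := Finset.univ) (t := Finset.univ) (f := fun i j => a j i)]
  have hden0 : 0 < 32 * G * μ + 8 * 1 * t₀ := by
    have : 0 ≤ G * μ := mul_nonneg (by linarith) hμ0
    linarith
  have hexp : L ≤ t₀ ^ 2 / (32 * G * μ + 8 * 1 * t₀) := by
    rw [le_div_iff₀ hden0, ht₀]
    nlinarith [hrsq, hr0, hL0.le, mul_nonneg hr0 hL0.le, mul_nonneg (by linarith : (0 : ℝ) ≤ G) hμ0]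
  -- Bernstein for `a' j i := a i j ∈ [0, 1]`
  have hBound := card_permutedSum_tail_le (n := n) 1 (fun j i => a i j)
    (fun j i => abs_le.2 ⟨by linarith [ha0 i j], ha1 i j⟩) t₀ ht₀0
  rw [hproxy, hmean] at hBound
  have htail : 2 * (n.factorial : ℝ) *
      Real.exp (-(t₀ ^ 2 / (32 * G * μ + 8 * 1 * t₀))) ≤ α / n := by
    have h1 : Real.exp (-(t₀ ^ 2 / (32 * G * μ + 8 * 1 * t₀))) ≤ Real.exp (-L) :=
      Real.exp_le_exp.2 (neg_le_neg hexp)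
    have h2 : Real.exp (-L) = α / (4 * n * n.factorial) := by
      rw [Real.exp_neg, hL, ← hα, Real.exp_log hY0, inv_div]
    have hf0 : (0 : ℝ) < n.factorial := by exact_mod_cast n.factorial_pos
    calc 2 * (n.factorial : ℝ) * Real.exp (-(t₀ ^ 2 / (32 * G * μ + 8 * 1 * t₀)))
        ≤ 2 * (n.factorial : ℝ) * Real.exp (-L) := by gcongr
      _ = α / n / 2 := by rw [h2]; field_simp; ring
      _ ≤ α / n := by linarith [div_nonneg hα0.le hn0.le]
  -- split `X` at the threshold (upper tail)
  set B := X.filter fun x => μ + t₀ ≤ ∑ j : Fin n, a (x j) j with hB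
  have hBsub : B.card ≤ (Finset.univ.filter fun π : Equiv.Perm (Fin n) =>
      t₀ ≤ |∑ j : Fin n, a (π j) j - μ|).card := by
    refine Finset.card_le_card fun x hx => ?_
    rw [Finset.mem_filter] at hx ⊢
    refine ⟨Finset.mem_univ _, ?_⟩
    have h2 := hx.2
    exact le_trans (by linarith) (le_abs_self _)
  have hBcard : (B.card : ℝ) ≤ α / n := by
    calc (B.card : ℝ) ≤ ((Finset.univ.filter fun π : Equiv.Perm (Fin n) =>
          t₀ ≤ |∑ j : Fin n, a (π j) j - μ|).card : ℝ) := by exact_mod_cast hBsub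
      _ ≤ _ := hBound
      _ ≤ α / n := htail
  -- `S = Σ_{x ∈ X} W x ≤ n · |B| + α (μ + t₀)`
  have hsplit : S ≤ n * B.card + α * (μ + t₀) := by
    rw [← hkey, ← Finset.sum_filter_add_sum_filter_not X (fun x => μ + t₀ ≤ ∑ j : Fin n, a (x j) j)]
    have h1 : ∑ x ∈ X.filter (fun x => μ + t₀ ≤ ∑ j : Fin n, a (x j) j), ∑ j : Fin n, a (x j) j ≤
        n * B.card := by
      rw [← hB]
      calc ∑ x ∈ B, ∑ j : Fin n, a (x j) j ≤ ∑ _x ∈ B, (n : ℝ) := Finset.sum_le_sum fun x _ => hFle x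
        _ = n * B.card := by rw [Finset.sum_const, nsmul_eq_mul, mul_comm]
    have h2 : ∑ x ∈ X.filter (fun x => ¬ (μ + t₀ ≤ ∑ j : Fin n, a (x j) j)), ∑ j : Fin n, a (x j) j ≤
        α * (μ + t₀) := by
      calc ∑ x ∈ X.filter (fun x => ¬ (μ + t₀ ≤ ∑ j : Fin n, a (x j) j)), ∑ j : Fin n, a (x j) j
          ≤ ∑ _x ∈ X.filter (fun x => ¬ (μ + t₀ ≤ ∑ j : Fin n, a (x j) j)), (μ + t₀) :=
            Finset.sum_le_sum fun x hx => (not_le.1 (Finset.mem_filter.1 hx).2).le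
        _ = (μ + t₀) * (X.filter (fun x => ¬ (μ + t₀ ≤ ∑ j : Fin n, a (x j) j))).card := by
            rw [Finset.sum_const, nsmul_eq_mul, mul_comm]
        _ ≤ (μ + t₀) * α := by
            rw [hα]
            exact mul_le_mul_of_nonneg_left (by exact_mod_cast Finset.card_filter_le _ _)
              (by linarith)
        _ = α * (μ + t₀) := mul_comm _ _
    linarith
  -- hence `S ≤ α (1 + μ + t₀)`
  have hS1 : S ≤ α * (1 + μ + t₀) := by
    have h1 : (n : ℝ) * B.card ≤ n * (α / n) := mul_le_mul_of_nonneg_left hBcard hn0.le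
    have h2 : (n : ℝ) * (α / n) = α := by field_simp
    rw [h2] at h1
    linarith
  -- normalise: `s = S / α` satisfies `s ≤ 1 + μ + t₀` and `16 μ ≤ λ μ ≤ s`
  set s : ℝ := S / α with hsdef
  have hs1 : s ≤ 1 + μ + t₀ := by
    rw [hsdef, div_le_iff₀ hα0]; linarith
  have hs2 : 16 * μ ≤ s := by
    rw [hsdef, le_div_iff₀ hα0]
    have := mul_nonneg (mul_nonneg (sub_nonneg.2 hlam) hα0.le) hμ0
    nlinarith [hμS, this]
  have hs0 : 0 ≤ s := by linarith
  -- AM-GM: `r = √(64 G μ L) ≤ √(4 G s L) ≤ s/4 + 4 G L`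
  have hamgm : r ≤ s / 4 + 4 * G * L := by
    have hS0 : 0 ≤ s / 4 + 4 * G * L := by linarith
    have hsq' : r ^ 2 ≤ (s / 4 + 4 * G * L) ^ 2 := by
      have e1 : r ^ 2 = 64 * G * μ * L := by rw [sq]; exact hrsq
      have e2 : 64 * G * μ * L ≤ 4 * G * s * L := by
        have := mul_nonneg hGL (sub_nonneg.2 hs2)
        nlinarith [this]
      nlinarith [sq_nonneg (s / 4 - 4 * G * L), e1, e2]
    exact (pow_le_pow_iff_left₀ hr0 hS0 two_ne_zero).1 hsq'
  -- `(11/16) s ≤ 1 + 4 G L + 16 L ≤ 21 G L`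
  have hLGL : L ≤ G * L := by nlinarith [hG1, hL0.le]
  have hsGL : s ≤ 200 * G * L := by
    have h1 : s ≤ 1 + μ + (r + 16 * L) := by rw [ht₀] at hs1; exact hs1
    nlinarith [hs2, hamgm, hL1, hLGL, hGL, h1, hμ0]
  have hS200 : S ≤ 200 * G * α * L := by
    have h := hsGL
    rw [hsdef, div_le_iff₀ hα0] at h
    linarith
  calc ∑ i : Fin n, ∑ j : Fin n, (if c ≤ M i j then M i j else 0) = S := hLS
    _ ≤ 200 * G * α * L := hS200
    _ = 200 * (1 + Real.log n) * X.card * Real.log (4 * n * n.factorial / X.card) := by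
        rw [hL, hG, ← hα]

end Summit.MatrixMultiplication.MatrixMultiplication.Theorems.PolynomialSlack
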